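import Mathlib
import Summits.Ventures.PercRepro2.ZMeanProof
import Summits.Ventures.PercRepro2.PendantRoot
import Summits.Ventures.PercRepro2.HMFLeaf
import Summits.Ventures.PercRepro2.HMFLeafStep
import Summits.Ventures.PercRepro2.HMFTwoRootStar
import Summits.Ventures.PercRepro2.HMFTwoRootMass
import Summits.Ventures.PercRepro2.HMFTwoRootTransport
import Summits.Ventures.PercRepro2.HMFTwoRoot
import Summits.Ventures.PercRepro2.GcTransport
import Summits.Ventures.PercRepro2.HMFLeafRB
import Summits.Ventures.PercRepro2.HMFSureEdge
import Summits.Ventures.PercRepro2.HMFLeafInvisible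
import Summits.Ventures.PercRepro2.HMFLoop

/-!
# (HMF) at the contracted instance of the class «a₃ pendant at u, N(u) = {a₁, a₂, a₃}»
(blind cell PercRepro2, night-1 g7; NIGHT1-G7.md §7, NIGHT1-POCKET.md)

Let `a₃` be a leaf with edge `f = {a₃, u}`, and let `u` carry exactly the edges `f`, `f₁ = {u, a₁}`,
`f₂ = {u, a₂}`.  With `f` sure and the mark moved to `u` (`HMFSureEdge`), the instance has the mark `u`
with an unmarked leaf `a₃` attached — invisible to `HMFc` (`HMFLeafInvisible.HMFc_update_leaf`), so the
weight of `f` may be set to `0`; pinned closed is re-routed to a loop at `a₃`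
(`HMFLoop.HMFc_update_zero_eq_loop`), and in the loop graph `u` carries exactly the two root edges, so
g6's two-root theorem `HMFTwoRoot.HMF_two_root` applies: **`HMF (p[f ↦ 1]) … u …`**
(`HMF_contract_star`).  This is hypothesis (i) of the leaf step `HMFLeafStep.HMF_of_leaf_step_relabel`
for the class; hypothesis (ii), `κ ≥ 0`, is NIGHT1-G7.md §7.
-/

namespace Summit.Ventures.PercRepro2

open UnionCluster CovForm PendantRoot HMFTwoRoot RECM

namespace HMFStarLeaf

open scoped Classical

variable {V : Type*} {E : Type*} [Fintype E] [DecidableEq E] [Fintype V] [DecidableEq V]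
  {R : Type*} [Field R] [LinearOrder R] [IsStrictOrderedRing R]

variable (p : E → R) (ends : E → Sym2 V) {f f₁ f₂ : E} {a₃ u a₁ a₂ : V}

omit [Fintype E] [Fintype V] [DecidableEq V] [LinearOrder R] [IsStrictOrderedRing R] in
/-- In the loop graph the star at `u` is `{f₁, f₂}`. -/
lemma hstar_loop (hf : ends f = s(a₃, u))
    (hstar : ∀ e, u ∈ ends e → e = f ∨ e = f₁ ∨ e = f₂) (h3u : a₃ ≠ u) :
    ∀ e, u ∈ (Function.update ends f s(a₃, a₃)) e → e = f₁ ∨ e = f₂ := by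
  intro e he
  by_cases hef : e = f
  · subst hef
    rw [Function.update_self] at he
    rcases Sym2.mem_iff.1 he with h | h <;> exact absurd h.symm h3u
  · rw [Function.update_of_ne hef] at he
    rcases hstar e he with h | h | h
    · exact absurd h hef
    · exact Or.inl h
    · exact Or.inr h

/-- **(HMF) at the contracted instance with the mark at `u`.** -/
theorem HMF_contract_star (hp : IsProbVec p) (hf : ends f = s(a₃, u)) (hf₁ : ends f₁ = s(u, a₁))
    (hf₂ : ends f₂ = s(u, a₂)) (hleaf : ∀ e, a₃ ∈ ends e → e = f)
    (hstar : ∀ e, u ∈ ends e → e = f ∨ e = f₁ ∨ e = f₂) (h3u : a₃ ≠ u) {o b : V}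
    (h3o : a₃ ≠ o) (h31 : a₃ ≠ a₁) (h32 : a₃ ≠ a₂) (h3b : a₃ ≠ b) (hu1 : u ≠ a₁) (hu2 : u ≠ a₂)
    (hroots : a₁ ≠ a₂) (ho : o ≠ u) (hb : b ≠ u) :
    HMF (Function.update p f 1) ends o a₁ a₂ u b := by
  unfold HMF
  -- the unmarked leaf `a₃` is invisible: move the weight of `f` to `0`
  rw [HMFLeafInvisible.HMFc_update_leaf p hf hleaf h3u h3o h31 h32 h3u h3b 1,
    ← HMFLeafInvisible.HMFc_update_leaf p hf hleaf h3u h3o h31 h32 h3u h3b 0,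
    HMFLoop.HMFc_update_zero_eq_loop p ends f a₃ o a₁ a₂ u b]
  -- in the loop graph `u` is adjacent only to the two roots
  have hff₁ : f ≠ f₁ := by
    intro h; rw [h, hf₁] at hf
    rcases Sym2.eq_iff.1 hf with ⟨h', _⟩ | ⟨_, h'⟩
    · exact h3u h'.symm
    · exact h31 h'.symm
  have hff₂ : f ≠ f₂ := by
    intro h; rw [h, hf₂] at hf
    rcases Sym2.eq_iff.1 hf with ⟨h', _⟩ | ⟨_, h'⟩
    · exact h3u h'.symm
    · exact h32 h'.symm
  have hf₁' : (Function.update ends f s(a₃, a₃)) f₁ = s(u, a₁) := by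
    rw [Function.update_of_ne (Ne.symm hff₁), hf₁]
  have hf₂' : (Function.update ends f s(a₃, a₃)) f₂ = s(u, a₂) := by
    rw [Function.update_of_ne (Ne.symm hff₂), hf₂]
  exact HMF_two_root p (Function.update ends f s(a₃, a₃)) hp hf₁' hf₂'
    (hstar_loop ends hf hstar h3u) hu1 hu2 hroots ho hb

section Kappa

variable {p ends}
variable (hp : IsProbVec p) (hf : ends f = s(a₃, u)) (hf₁ : ends f₁ = s(u, a₁)) (hf₂ : ends f₂ = s(u, a₂))
  (hleaf : ∀ e, a₃ ∈ ends e → e = f) (hstar : ∀ e, u ∈ ends e → e = f ∨ e = f₁ ∨ e = f₂)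
  (h3u : a₃ ≠ u) {o b : V} (h3o : a₃ ≠ o) (h31 : a₃ ≠ a₁) (h32 : a₃ ≠ a₂) (h3b : a₃ ≠ b)
  (hu1 : u ≠ a₁) (hu2 : u ≠ a₂) (hroots : a₁ ≠ a₂) (ho : o ≠ u) (hb : b ≠ u)

include hp hf hf₁ hf₂ hleaf hstar h3u h3o h31 h32 h3b hu1 hu2 hroots ho hb

/-- **The attachment coefficient of the class is the two-root bracket combination**:
`κ = 2 (1 − αβ)(α + β − 2αβ) Z₀ · [β(1−α) Θ_h + α(1−β) Θ_l]` (the star masses of the loop graph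
`ends' = ends[f ↦ s(a₃, a₃)]` with the mark `u`). -/
theorem kappa_star_eq :
    4 * HMFc (Function.update p f (1 / 2)) ends o a₁ a₂ a₃ b -
        2 * HMFc (Function.update p f 1) ends o a₁ a₂ u b =
      2 * (1 - p f₁ * p f₂) * (p f₁ + p f₂ - 2 * p f₁ * p f₂) *
        prob p (Q₀ (Function.update ends f s(a₃, a₃)) f₁ f₂ a₁ a₂) *
        (p f₂ * (1 - p f₁) *
            (prob p (Q₀ (Function.update ends f s(a₃, a₃)) f₁ f₂ a₁ a₂ ∩
                  connEvent₀ (Function.update ends f s(a₃, a₃)) f₁ f₂ a₁ o) *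
                (prob p (Q₀ (Function.update ends f s(a₃, a₃)) f₁ f₂ a₁ a₂ ∩
                    connEvent₀ (Function.update ends f s(a₃, a₃)) f₁ f₂ a₂ b) -
                  prob p (Q₀ (Function.update ends f s(a₃, a₃)) f₁ f₂ a₁ a₂ ∩
                    connEvent₀ (Function.update ends f s(a₃, a₃)) f₁ f₂ a₁ b)) -
              prob p (Q₀ (Function.update ends f s(a₃, a₃)) f₁ f₂ a₁ a₂) *
                prob p (Q₀ (Function.update ends f s(a₃, a₃)) f₁ f₂ a₁ a₂ ∩
                  (connEvent₀ (Function.update ends f s(a₃, a₃)) f₁ f₂ a₂ b ∩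
                    connEvent₀ (Function.update ends f s(a₃, a₃)) f₁ f₂ a₁ o)) +
              prob p (Q₀ (Function.update ends f s(a₃, a₃)) f₁ f₂ a₁ a₂) *
                HMFPendantRoot.Eprod (Function.update p f₁ 0) (Function.update ends f s(a₃, a₃)) f₂ o a₁ a₂ b) +
          p f₁ * (1 - p f₂) *
            (prob p (Q₀ (Function.update ends f s(a₃, a₃)) f₁ f₂ a₁ a₂ ∩
                  connEvent₀ (Function.update ends f s(a₃, a₃)) f₁ f₂ a₂ o) *
                (prob p (Q₀ (Function.update ends f s(a₃, a₃)) f₁ f₂ a₁ a₂ ∩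
                    connEvent₀ (Function.update ends f s(a₃, a₃)) f₁ f₂ a₁ b) -
                  prob p (Q₀ (Function.update ends f s(a₃, a₃)) f₁ f₂ a₁ a₂ ∩
                    connEvent₀ (Function.update ends f s(a₃, a₃)) f₁ f₂ a₂ b)) -
              prob p (Q₀ (Function.update ends f s(a₃, a₃)) f₁ f₂ a₁ a₂) *
                prob p (Q₀ (Function.update ends f s(a₃, a₃)) f₁ f₂ a₁ a₂ ∩
                  (connEvent₀ (Function.update ends f s(a₃, a₃)) f₁ f₂ a₁ b ∩
                    connEvent₀ (Function.update ends f s(a₃, a₃)) f₁ f₂ a₂ o)) +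
              prob p (Q₀ (Function.update ends f s(a₃, a₃)) f₁ f₂ a₁ a₂) *
                HMFPendantRoot.Eprod (Function.update p f₂ 0) (Function.update ends f s(a₃, a₃)) f₁ o a₂ a₁ b)) := by
  set ends' := Function.update ends f s(a₃, a₃) with hends'
  set p1 := Function.update p f 1 with hp1def
  have hp1 : IsProbVec p1 := hp.update f zero_le_one le_rfl
  have hp1f : p1 f = 1 := by simp [hp1def]
  -- the leaf edge is distinct from the star edges; the star in the loop graph
  have hff₁ : f ≠ f₁ := by
    intro h; rw [h, hf₁] at hf
    rcases Sym2.eq_iff.1 hf with ⟨h', _⟩ | ⟨_, h'⟩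
    · exact h3u h'.symm
    · exact h31 h'.symm
  have hff₂ : f ≠ f₂ := by
    intro h; rw [h, hf₂] at hf
    rcases Sym2.eq_iff.1 hf with ⟨h', _⟩ | ⟨_, h'⟩
    · exact h3u h'.symm
    · exact h32 h'.symm
  have h12 : f₁ ≠ f₂ := by
    intro h; rw [h, hf₂] at hf₁
    rcases Sym2.eq_iff.1 hf₁ with ⟨_, h'⟩ | ⟨h', _⟩
    · exact hroots h'.symm
    · exact hu1 h'
  have hf₁' : ends' f₁ = s(u, a₁) := by rw [hends', Function.update_of_ne (Ne.symm hff₁), hf₁]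
  have hf₂' : ends' f₂ = s(u, a₂) := by rw [hends', Function.update_of_ne (Ne.symm hff₂), hf₂]
  have hstar' : ∀ e, u ∈ ends' e → e = f₁ ∨ e = f₂ := hstar_loop ends hf hstar h3u
  -- connectivity transport to the loop graph
  have hH : ∀ ω x z, Conn ends (Function.update ω f false) x z ↔ Conn ends' ω (id x) (id z) :=
    fun ω x z => conn_update_false_iff_loop ends f a₃ ω x z
  -- freeness of the `u`-marked events (the leaf `a₃` is unmarked)
  have hc : ∀ x z : V, x ≠ a₃ → z ≠ a₃ → Free f (connEvent ends x z) := fun x z hx hz =>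
    free_connEvent hf hleaf h3u hx hz
  have hQ : Free f (avoidAll ends a₂ {a₁}) := by
    rw [avoidAll_eq_compl]; exact (hc a₁ a₂ h31.symm h32.symm).compl
  have hPDu : Free f (PDEvent ends a₁ a₂ u) := by
    unfold PDEvent Dtilde UnionCluster.inU
    exact (hc a₁ a₂ h31.symm h32.symm).compl.inter
      (HMFLeafInvisible.free_union (hc u a₁ h3u.symm h31.symm) (hc u a₂ h3u.symm h32.symm)).compl
  have hTu : Free f (TEvent ends a₁ a₂ u) := by
    unfold TEvent; exact (hc a₂ a₁ h32.symm h31.symm).compl.inter (hc a₂ u h32.symm h3u.symm)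
  have hT'u : Free f (TEvent ends a₂ a₁ u) := by
    unfold TEvent; exact (hc a₁ a₂ h31.symm h32.symm).compl.inter (hc a₁ u h31.symm h3u.symm)
  -- the three-step transport of a `p1`-mass with the mark `a₃` to the loop graph with the mark `u`
  have tr : ∀ (A A' B : Set (Config E)), A ∩ openEdge f = A' ∩ openEdge f → Free f A' →
      (fun ω => Function.update ω f false) ⁻¹' A' = B → prob p1 A = prob p B := by
    intro A A' B hAA hA' hB
    rw [HMFSureEdge.prob_eq_of_inter_open p1 hp1 hp1f hAA, hp1def,
      PendantEdm.prob_update_of_free p hA' 1, ← PendantEdm.prob_update_of_free p hA' 0,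
      prob_update_zero_eq_preimage, hB]
  have trf : ∀ (A B : Set (Config E)), Free f A →
      (fun ω => Function.update ω f false) ⁻¹' A = B → prob p A = prob p B := by
    intro A B hA hB
    rw [← PendantEdm.prob_update_of_free p hA 0, prob_update_zero_eq_preimage, hB]
  have hXrel : Xhat p1 ends o a₁ a₂ a₃ b = Xhat p ends' o a₁ a₂ u b := by
    have h1 : Xhat p1 ends o a₁ a₂ a₃ b = Xhat p1 ends o a₁ a₂ u b := by
      rw [Xhat_eq_sum, Xhat_eq_sum]
      refine Finset.sum_congr rfl fun W _ => ?_
      rw [HMFSureEdge.prob_eq_of_inter_open p1 hp1 hp1f (HMFSureEdge.cluster_inter_open hf (↑W : Set V))]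
    rw [h1, hp1def, HMFLeafInvisible.Xhat_update_leaf p hf hleaf h3u h3o h31 h32 h3u.symm h3b 1,
      ← HMFLeafInvisible.Xhat_update_leaf p hf hleaf h3u h3o h31 h32 h3u.symm h3b 0,
      HMFLoop.Xhat_update_zero_eq_loop p ends f a₃ o a₁ a₂ u b]
  -- the individual masses
  have mZ : prob p (avoidAll ends a₂ {a₁}) = prob p (avoidAll ends' a₂ {a₁}) :=
    trf _ _ hQ (by rw [preimage_avoidAll_singleton hH]; rfl)
  have mQ : ∀ x z : V, x ≠ a₃ → z ≠ a₃ →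
      prob p (avoidAll ends a₂ {a₁} ∩ connEvent ends x z) =
        prob p (avoidAll ends' a₂ {a₁} ∩ connEvent ends' x z) := fun x z hx hz =>
    trf _ _ (hQ.inter (hc x z hx hz))
      (by rw [Set.preimage_inter, preimage_avoidAll_singleton hH, preimage_connEvent hH]; rfl)
  have mPD : prob p1 (PDEvent ends a₁ a₂ a₃) = prob p (PDEvent ends' a₁ a₂ u) :=
    tr _ _ _ (HMFSureEdge.PD_inter_open hf a₁ a₂) hPDu (by rw [preimage_PDEvent hH]; rfl)
  have mPDX : ∀ x z : V, x ≠ a₃ → z ≠ a₃ →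
      prob p1 (PDEvent ends a₁ a₂ a₃ ∩ connEvent ends x z) =
        prob p (PDEvent ends' a₁ a₂ u ∩ connEvent ends' x z) := fun x z hx hz =>
    tr _ _ _ (HMFSureEdge.inter_open_congr (HMFSureEdge.PD_inter_open hf a₁ a₂)) (hPDu.inter (hc x z hx hz))
      (by rw [Set.preimage_inter, preimage_PDEvent hH, preimage_connEvent hH]; rfl)
  have mT : prob p1 (TEvent ends a₁ a₂ a₃) = prob p (TEvent ends' a₁ a₂ u) :=
    tr _ _ _ (HMFSureEdge.T_inter_open hf a₁ a₂) hTu (by rw [preimage_TEvent hH]; rfl)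
  have mT' : prob p1 (TEvent ends a₂ a₁ a₃) = prob p (TEvent ends' a₂ a₁ u) :=
    tr _ _ _ (HMFSureEdge.T_inter_open hf a₂ a₁) hT'u (by rw [preimage_TEvent hH]; rfl)
  have mTX : ∀ x z : V, x ≠ a₃ → z ≠ a₃ →
      prob p1 (TEvent ends a₁ a₂ a₃ ∩ connEvent ends x z) =
        prob p (TEvent ends' a₁ a₂ u ∩ connEvent ends' x z) := fun x z hx hz =>
    tr _ _ _ (HMFSureEdge.inter_open_congr (HMFSureEdge.T_inter_open hf a₁ a₂)) (hTu.inter (hc x z hx hz))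
      (by rw [Set.preimage_inter, preimage_TEvent hH, preimage_connEvent hH]; rfl)
  have mT'X : ∀ x z : V, x ≠ a₃ → z ≠ a₃ →
      prob p1 (TEvent ends a₂ a₁ a₃ ∩ connEvent ends x z) =
        prob p (TEvent ends' a₂ a₁ u ∩ connEvent ends' x z) := fun x z hx hz =>
    tr _ _ _ (HMFSureEdge.inter_open_congr (HMFSureEdge.T_inter_open hf a₂ a₁)) (hT'u.inter (hc x z hx hz))
      (by rw [Set.preimage_inter, preimage_TEvent hH, preimage_connEvent hH]; rfl)
  have mXT : ∀ x z : V, x ≠ a₃ → z ≠ a₃ →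
      prob p1 (connEvent ends x z ∩ TEvent ends a₁ a₂ a₃) =
        prob p (connEvent ends' x z ∩ TEvent ends' a₁ a₂ u) := fun x z hx hz =>
    tr _ _ _ (HMFSureEdge.inter_open_congr' (HMFSureEdge.T_inter_open hf a₁ a₂)) ((hc x z hx hz).inter hTu)
      (by rw [Set.preimage_inter, preimage_TEvent hH, preimage_connEvent hH]; rfl)
  -- the leaf step's closed form, transported
  rw [← HMFSureEdge.HMFc_relabel_of_sure p1 ends hp1 hf hp1f o a₁ a₂ b,
    HMFLeafStep.kappa_eq p ends hp hf hleaf h3u h31 h32 h3o.symm h3b.symm]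
  simp only [Do, massM2, deltaT, EQ3, EQ3o]
  rw [hXrel, mZ, mQ a₁ o h31.symm h3o.symm, mQ a₂ o h32.symm h3o.symm, mQ a₂ b h32.symm h3b.symm,
    mQ a₁ b h31.symm h3b.symm, mPD, mPDX a₁ o h31.symm h3o.symm, mPDX a₂ o h32.symm h3o.symm,
    mPDX a₂ b h32.symm h3b.symm, mT, mT', mTX a₁ o h31.symm h3o.symm, mTX a₂ o h32.symm h3o.symm,
    mT'X a₁ o h31.symm h3o.symm, mT'X a₂ o h32.symm h3o.symm, mXT a₂ b h32.symm h3b.symm,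
    mXT a₁ b h31.symm h3b.symm]
  -- the star masses of the loop graph (g6's two-root machinery with the mark `u`)
  have ht := termW_leaf_star p ends' hp hf₁' hf₂' hstar' hu1 hu2 ho hb
  have hHv := HMFPendantRoot.expect_Fheavy (Function.update p f₁ 0) ends' (f := f₂) (a₂ := a₂) o a₁ b
  have hLv := HMFPendantRoot.expect_Fheavy (Function.update p f₂ 0) ends' (f := f₁) (a₂ := a₁) o a₂ b
  have hPh := transport_h p ends' hf₁' hf₂' hstar' hu1 hu2 h12
    (X := connEvent ends' a₂ b ∩ connEvent ends' a₁ o)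
    (X₀ := connEvent₀ ends' f₁ f₂ a₂ b ∩ connEvent₀ ends' f₁ f₂ a₁ o)
    (fun _ hnb => mem_two_iff ends' hf₁' hf₂' hstar' hu2.symm hb hu1.symm ho hnb)
    (dependsOn_conn₀_inter ends' a₂ b a₁ o)
  have hPl := transport_l p ends' hf₁' hf₂' hstar' hu1 hu2 h12
    (X := connEvent ends' a₁ b ∩ connEvent ends' a₂ o)
    (X₀ := connEvent₀ ends' f₁ f₂ a₁ b ∩ connEvent₀ ends' f₁ f₂ a₂ o)
    (fun _ hnb => mem_two_iff ends' hf₁' hf₂' hstar' hu1.symm hb hu2.symm ho hnb)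
    (dependsOn_conn₀_inter ends' a₁ b a₂ o)
  rw [Xhat_star p ends' hf₁' hf₂' hstar' h12 o b, heavy_sum_star p ends' hf₁' hf₂' h12 o b,
    light_sum_star p ends' hf₁' hf₂' h12 o b, hHv, hLv, hPh, hPl,
    Set.inter_comm (connEvent ends' a₂ b) (TEvent ends' a₁ a₂ u),
    Set.inter_comm (connEvent ends' a₁ b) (TEvent ends' a₁ a₂ u)]
  simp only [prob_PD_star_X p ends' hf₁' hf₂' hstar' hu1 hu2 h12 hu1.symm ho,
    prob_PD_star_X p ends' hf₁' hf₂' hstar' hu1 hu2 h12 hu2.symm ho,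
    prob_PD_star_X p ends' hf₁' hf₂' hstar' hu1 hu2 h12 hu2.symm hb,
    prob_T_star_X p ends' hf₁' hf₂' hstar' hu1 hu2 h12 hu1.symm ho,
    prob_T_star_X p ends' hf₁' hf₂' hstar' hu1 hu2 h12 hu2.symm ho,
    prob_T_star_X p ends' hf₁' hf₂' hstar' hu1 hu2 h12 hu1.symm hb,
    prob_T_star_X p ends' hf₁' hf₂' hstar' hu1 hu2 h12 hu2.symm hb,
    prob_T'_star_X p ends' hf₁' hf₂' hstar' hu1 hu2 h12 hu1.symm ho,
    prob_T'_star_X p ends' hf₁' hf₂' hstar' hu1 hu2 h12 hu2.symm ho,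
    prob_Q_star_X p ends' hf₁' hf₂' hstar' hu1 hu2 h12 hu1.symm ho,
    prob_Q_star_X p ends' hf₁' hf₂' hstar' hu1 hu2 h12 hu2.symm ho,
    prob_Q_star_X p ends' hf₁' hf₂' hstar' hu1 hu2 h12 hu1.symm hb,
    prob_Q_star_X p ends' hf₁' hf₂' hstar' hu1 hu2 h12 hu2.symm hb,
    prob_PD_star p ends' hf₁' hf₂' hstar' hu1 hu2 h12, prob_T_star p ends' hf₁' hf₂' hstar' hu1 hu2 h12,
    prob_T'_star p ends' hf₁' hf₂' hstar' hu1 hu2 h12, prob_Q_star p ends' hf₁' hf₂' hstar' hu1 hu2 h12]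
  linear_combination (-2 * (1 - p f₁ * p f₂) * (p f₁ + p f₂ - 2 * p f₁ * p f₂) * (1 - p f₁) * (1 - p f₂) *
    prob p (Q₀ ends' f₁ f₂ a₁ a₂)) * ht

/-- **The attachment coefficient of the class is nonnegative** ((ATT-u) for `N(u) = {a₁, a₂, a₃}`). -/
theorem kappa_star_nonneg :
    0 ≤ 4 * HMFc (Function.update p f (1 / 2)) ends o a₁ a₂ a₃ b -
        2 * HMFc (Function.update p f 1) ends o a₁ a₂ u b := by
  rw [kappa_star_eq hp hf hf₁ hf₂ hleaf hstar h3u h3o h31 h32 h3b hu1 hu2 hroots ho hb]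
  set ends' := Function.update ends f s(a₃, a₃) with hends'
  have hff₁ : f ≠ f₁ := by
    intro h; rw [h, hf₁] at hf
    rcases Sym2.eq_iff.1 hf with ⟨h', _⟩ | ⟨_, h'⟩
    · exact h3u h'.symm
    · exact h31 h'.symm
  have hff₂ : f ≠ f₂ := by
    intro h; rw [h, hf₂] at hf
    rcases Sym2.eq_iff.1 hf with ⟨h', _⟩ | ⟨_, h'⟩
    · exact h3u h'.symm
    · exact h32 h'.symm
  have h12 : f₁ ≠ f₂ := by
    intro h; rw [h, hf₂] at hf₁
    rcases Sym2.eq_iff.1 hf₁ with ⟨_, h'⟩ | ⟨h', _⟩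
    · exact hroots h'.symm
    · exact hu1 h'
  have hf₁' : ends' f₁ = s(u, a₁) := by rw [hends', Function.update_of_ne (Ne.symm hff₁), hf₁]
  have hf₂' : ends' f₂ = s(u, a₂) := by rw [hends', Function.update_of_ne (Ne.symm hff₂), hf₂]
  have hstar' : ∀ e, u ∈ ends' e → e = f₁ ∨ e = f₂ := hstar_loop ends hf hstar h3u
  have h1u : a₁ ≠ u := Ne.symm hu1
  have h2u : a₂ ≠ u := Ne.symm hu2
  have hp1 : IsProbVec (Function.update p f₁ 0) := hp.update f₁ le_rfl zero_le_one
  have hp2 : IsProbVec (Function.update p f₂ 0) := hp.update f₂ le_rfl zero_le_one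
  -- the heavy cluster: same-cluster BHK (functional) and cross BHK, transported
  have hs := HMFPendantRoot.bhk_same_heavy (Function.update p f₁ 0) ends' (f := f₂) (a₂ := a₂) hp1 o a₁ b
  have hc := HMFPendantRoot.bhk_cross_heavy (Function.update p f₁ 0) ends' (f := f₂) (a₂ := a₂) hp1 o a₁ b
  have t1 := transport_h p ends' hf₁' hf₂' hstar' hu1 hu2 h12 (X := connEvent ends' a₁ o)
    (X₀ := connEvent₀ ends' f₁ f₂ a₁ o) (fun _ hnb => mem_conn_iff_conn₀ ends' hf₁' hf₂' hstar' h1u ho hnb)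
    (dependsOn_connEvent₀ a₁ o)
  have t2 := transport_h p ends' hf₁' hf₂' hstar' hu1 hu2 h12 (X := connEvent ends' a₁ b)
    (X₀ := connEvent₀ ends' f₁ f₂ a₁ b) (fun _ hnb => mem_conn_iff_conn₀ ends' hf₁' hf₂' hstar' h1u hb hnb)
    (dependsOn_connEvent₀ a₁ b)
  have t3 := transport_h p ends' hf₁' hf₂' hstar' hu1 hu2 h12 (X := connEvent ends' a₂ b)
    (X₀ := connEvent₀ ends' f₁ f₂ a₂ b) (fun _ hnb => mem_conn_iff_conn₀ ends' hf₁' hf₂' hstar' h2u hb hnb)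
    (dependsOn_connEvent₀ a₂ b)
  have t4 := transport_h p ends' hf₁' hf₂' hstar' hu1 hu2 h12
    (X := connEvent ends' a₂ b ∩ connEvent ends' a₁ o)
    (X₀ := connEvent₀ ends' f₁ f₂ a₂ b ∩ connEvent₀ ends' f₁ f₂ a₁ o)
    (fun _ hnb => mem_two_iff ends' hf₁' hf₂' hstar' h2u hb h1u ho hnb) (dependsOn_conn₀_inter ends' a₂ b a₁ o)
  have tQ := transport_h_Q p ends' hf₁' hf₂' hstar' hu1 hu2 h12
  rw [t1, t2, tQ] at hs
  rw [t4, tQ, t1, t3] at hc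
  -- the light cluster: the mirror
  have hs' := HMFPendantRoot.bhk_same_heavy (Function.update p f₂ 0) ends' (f := f₁) (a₂ := a₁) hp2 o a₂ b
  have hc' := HMFPendantRoot.bhk_cross_heavy (Function.update p f₂ 0) ends' (f := f₁) (a₂ := a₁) hp2 o a₂ b
  have u1 := transport_l p ends' hf₁' hf₂' hstar' hu1 hu2 h12 (X := connEvent ends' a₂ o)
    (X₀ := connEvent₀ ends' f₁ f₂ a₂ o) (fun _ hnb => mem_conn_iff_conn₀ ends' hf₁' hf₂' hstar' h2u ho hnb)
    (dependsOn_connEvent₀ a₂ o)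
  have u2 := transport_l p ends' hf₁' hf₂' hstar' hu1 hu2 h12 (X := connEvent ends' a₂ b)
    (X₀ := connEvent₀ ends' f₁ f₂ a₂ b) (fun _ hnb => mem_conn_iff_conn₀ ends' hf₁' hf₂' hstar' h2u hb hnb)
    (dependsOn_connEvent₀ a₂ b)
  have u3 := transport_l p ends' hf₁' hf₂' hstar' hu1 hu2 h12 (X := connEvent ends' a₁ b)
    (X₀ := connEvent₀ ends' f₁ f₂ a₁ b) (fun _ hnb => mem_conn_iff_conn₀ ends' hf₁' hf₂' hstar' h1u hb hnb)
    (dependsOn_connEvent₀ a₁ b)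
  have u4 := transport_l p ends' hf₁' hf₂' hstar' hu1 hu2 h12
    (X := connEvent ends' a₁ b ∩ connEvent ends' a₂ o)
    (X₀ := connEvent₀ ends' f₁ f₂ a₁ b ∩ connEvent₀ ends' f₁ f₂ a₂ o)
    (fun _ hnb => mem_two_iff ends' hf₁' hf₂' hstar' h1u hb h2u ho hnb) (dependsOn_conn₀_inter ends' a₁ b a₂ o)
  have uQ := transport_l_Q p ends' hf₁' hf₂' hstar' hu1 hu2 h12
  rw [u1, u2, uQ] at hs'
  rw [u4, uQ, u1, u3] at hc'
  -- signs
  have hq1 := hp.nonneg f₁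
  have hq1' := sub_nonneg.2 (hp.le_one f₁)
  have hq2 := hp.nonneg f₂
  have hq2' := sub_nonneg.2 (hp.le_one f₂)
  have hZ := prob_nonneg hp (Q₀ ends' f₁ f₂ a₁ a₂)
  have hab : 0 ≤ 1 - p f₁ * p f₂ := by
    have := mul_le_mul (hp.le_one f₁) (hp.le_one f₂) hq2 zero_le_one
    linarith
  have hd : 0 ≤ p f₁ + p f₂ - 2 * p f₁ * p f₂ := by nlinarith
  refine mul_nonneg (mul_nonneg (mul_nonneg (mul_nonneg (by norm_num) hab) hd) hZ) ?_
  refine add_nonneg (mul_nonneg (mul_nonneg hq2 hq1') ?_) (mul_nonneg (mul_nonneg hq1 hq2') ?_)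
  · nlinarith [hs, hc]
  · nlinarith [hs', hc']

/-- **(HMF) — hence (HCOV) — for `a₃` pendant at a vertex `u` adjacent only to the two roots**
(NIGHT1-G7.md §7; the first new class of the root-only-pocket theorem beyond HMFTwoRoot). -/
theorem HMF_star_leaf : HMF p ends o a₁ a₂ a₃ b := by
  have hp1 : IsProbVec (Function.update p f 1) := hp.update f zero_le_one le_rfl
  have hrel := HMFSureEdge.HMFc_relabel_of_sure (Function.update p f 1) ends hp1 hf (by simp) o a₁ a₂ b
  refine HMFLeafStep.HMF_of_leaf_step p ends hp hf hleaf h3u h31 h32 h3o.symm h3b.symm ?_ ?_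
  · rw [hrel]
    exact HMF_contract_star p ends hp hf hf₁ hf₂ hleaf hstar h3u h3o h31 h32 h3b hu1 hu2 hroots ho hb
  · rw [hrel]
    exact kappa_star_nonneg hp hf hf₁ hf₂ hleaf hstar h3u h3o h31 h32 h3b hu1 hu2 hroots ho hb

/-- **(HCOV) on the class.** -/
theorem HCov_star_leaf : CovForm.HCov p ends o a₁ a₂ a₃ b :=
  HCov_of_HMF p hp ends o a₁ a₂ a₃ b
    (HMF_star_leaf hp hf hf₁ hf₂ hleaf hstar h3u h3o h31 h32 h3b hu1 hu2 hroots ho hb)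


end Kappa

end HMFStarLeaf

end Summit.Ventures.PercRepro2
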